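import Literature.NumberTheory.EllipticCurves.PAdicLFunctionTameBirchMeasureProofs
import Literature.NumberTheory.EllipticCurves.PAdicLFunctionTameConvergenceProofs
import Literature.NumberTheory.EllipticCurves.PAdicMeasureTransformTranslationProofs
import Literature.NumberTheory.EllipticCurves.PAdicLFunctionTameDepletionFactorProofs
import HarnessLib

/-!
# Birch's lemma at the level of the TRANSFORMS: a symbol-level twisting relation makes
# `L_p(g, χ(p)α, T) = C(c) · (1+T)^{−f_m} · L_p(f, α, χ, T)` (PROOFS ONLY)

Cell bsd-2adic, seat conv-1 (planner RULING RC-159, road P4 — step P4c). With `μ_{g,χ(p)α}(x + pⁿℤ_p) =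
c Σ_b χ(b) μ_{f,α,m}((x·m + pⁿℤ_p) × {b})` (`msdMeasure_twist_eq_sum_msdMeasureTame`, step P4b, from the symbol relation `hB`), the
Riemann sums of `L_p(g, χ(p)α)` are `c` times the Riemann sums of the `χ`-weighted tame measure TRANSLATED by `m` on `ℤ_pˣ`
(`m ≡ ω(m) γ^{f_m}`, `exists_teichmuller_frobeniusExponent`), so by `tendsto_riemannSum_translate` (the `(1+T)^{−c}` twist of a
translated transform) every coefficient of `L_p(g, χ(p)α)` is `c Σ_{i≤k} (−f_m choose k−i) [T^i] L_p(f,α,χ)`: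

* `padicLRiemannSum_twist_eq` — the Riemann sums of `g` vs the translated weighted tame sums;
* `padicLCoeff_twist_eq` — the coefficient identity;
* **`padicLFunction_twist_eq_of_birch`** — `L_p(g, χ(p)α, T) = C(c) · (1+T)^{−f_m} · L_p(f, α, χ, T)` in `ℚ_p⟦T⟧`,
  `f_m = frobeniusExponent p m`, `χ` read in `ℚ_p` (`χ.ringHomComp (Rat.castHom ℚ_p)`).

Applied (road P4, successor) to `g = f_{E^{(d)}}`, `f = f_E`, `χ = χ_d`, `m = d`, `p = 2`, once the symbol relation `hB` (P4a) is
proved: `L₂(E^{(d)}, T) = unit · C(c) · L₂(f_E, α, χ_d, T)`, the input of the cell's congruence `hcong`.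

References: B. Mazur, J. Tate, J. Teitelbaum, Invent. Math. 84 (1986), §I.8–§I.13 [MazurTateTeitelbaum1986Invent]; K. Matsuno,
J. Number Theory 84 (2000), §2 (p. 84) [Matsuno2000].
-/

noncomputable section

open scoped MatrixGroups ModularForm

open CongruenceSubgroup Filter Topology PowerSeries Literature.NumberTheory.EllipticCurves.ModularForms
  Literature.NumberTheory.EllipticCurves.GreenbergVatsal2000

namespace Literature.NumberTheory.EllipticCurves

section BirchTransform

variable {N N' : ℕ} [NeZero N] [NeZero N'] (f : CuspForm (Gamma0 N) 2) (g : CuspForm (Gamma0 N') 2)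
  {p : ℕ} [Fact p.Prime] {m : ℕ} [NeZero m]

omit [NeZero N'] in
/-- **The Riemann sums of the twist are `c` times the TRANSLATED weighted tame sums**: under `hB`, for `m ≡ ω(m) γ^{f_m}`
(`teich`, `hc`), `padicLRiemannSum g (χ(p)α) k n = c · Σ_η Σ_s ν_χ((ω(m)γ^{f_m})·(ηγˢ)) C(s,k)`, `ν_χ(x) = Σ_b χ(b) μ_{f,α,m}(x × {b})`.
[cite: MazurTateTeitelbaum1986Invent, §I.8–I.13 (pp. 10–19)] -/
theorem padicLRiemannSum_twist_eq (hmp : m.Coprime p) (χ : MulChar (ZMod m) ℚ) (hχp : χ (p : ZMod m) ^ 2 = 1) {c : ℚ}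
    (hB : ∀ x : ℚ, ratPlusSymbol g x = c * ∑ b : ZMod m, χ b * ratPlusSymbol f (x + (b.val : ℚ) / m))
    (α : ℚ_[p]) {teich : rootsOfUnity (torsionOrder p) ℤ_[p]} {e : ℤ_[p]}
    (hc : ∀ n : ℕ, PadicInt.toZModPow (n + cyclotomicExponent p) ((teich : ℤ_[p]ˣ) : ℤ_[p]) *
        (cyclotomicGenerator p : ZMod (p ^ (n + cyclotomicExponent p))) ^ (PadicInt.toZModPow n e).val =
          (m : ZMod (p ^ (n + cyclotomicExponent p)))) (k n : ℕ) :
    padicLRiemannSum g (((χ (p : ZMod m) : ℚ) : ℚ_[p]) * α) k n =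
      (c : ℚ_[p]) * ∑ᶠ zz : rootsOfUnity (torsionOrder p) ℤ_[p], ∑ s : ZMod (p ^ n),
        (fun (n : ℕ) (a : ZMod (p ^ n)) ↦
            ∑ b : ZMod m, (χ.ringHomComp (Rat.castHom ℚ_[p])) b * msdMeasureTame f m α n a b)
          (n + cyclotomicExponent p)
          ((PadicInt.toZModPow (n + cyclotomicExponent p) ((teich : ℤ_[p]ˣ) : ℤ_[p]) *
              (cyclotomicGenerator p : ZMod (p ^ (n + cyclotomicExponent p))) ^ (PadicInt.toZModPow n e).val) *
            (PadicInt.toZModPow (n + cyclotomicExponent p) ((zz : ℤ_[p]ˣ) : ℤ_[p]) *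
              (cyclotomicGenerator p : ZMod (p ^ (n + cyclotomicExponent p))) ^ s.val)) *
          ((s.val.choose k : ℕ) : ℚ_[p]) := by
  classical
  haveI := neZero_torsionOrder p
  haveI := Fintype.ofFinite (rootsOfUnity (torsionOrder p) ℤ_[p])
  unfold padicLRiemannSum
  rw [finsum_eq_sum_of_fintype, finsum_eq_sum_of_fintype, Finset.mul_sum]
  refine Finset.sum_congr rfl fun zz _ ↦ ?_
  rw [Finset.mul_sum]
  refine Finset.sum_congr rfl fun s _ ↦ ?_
  rw [msdMeasure_twist_eq_sum_msdMeasureTame f g hmp χ hχp hB α, hc n, mul_comm (m : ZMod (p ^ (n + cyclotomicExponent p)))]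
  simp only [MulChar.ringHomComp_apply, eq_ratCast]
  ring

omit [NeZero N'] in
/-- **Birch's lemma for the coefficients**: under `hB` and the convergence hypotheses for `f` (rational normalised newform of level
prime to `p`, `(m,p) = 1`, `α` the unit root), `[T^k] L_p(g, χ(p)α) = c · Σ_{i≤k} (−f_m choose k−i) · [T^i] L_p(f, α, χ)`,
`f_m = frobeniusExponent p m` (`tendsto_riemannSum_translate` for the `χ`-weighted tame measure translated by `m`).
[cite: MazurTateTeitelbaum1986Invent, §I.8–I.13 (pp. 10–19)] [cite: Matsuno2000, §2 (p. 84)] -/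
theorem padicLCoeff_twist_eq (hf : IsNewform0 f) (hQ : coeffField f = ⊥) (hpN : ¬ p ∣ N) (hmp : m.Coprime p)
    {ap : ℤ} (hap : cuspCoeff f p = ap) {α : ℚ_[p]} (hα : α ^ 2 - ap * α + p = 0) (hαu : ‖α‖ = 1)
    (χ : MulChar (ZMod m) ℚ) (hχp : χ (p : ZMod m) ^ 2 = 1) {c : ℚ}
    (hB : ∀ x : ℚ, ratPlusSymbol g x = c * ∑ b : ZMod m, χ b * ratPlusSymbol f (x + (b.val : ℚ) / m)) (k : ℕ) :
    padicLCoeff g (((χ (p : ZMod m) : ℚ) : ℚ_[p]) * α) k =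
      (c : ℚ_[p]) * ∑ i ∈ Finset.range (k + 1),
        algebraMap ℤ_[p] ℚ_[p] (Ring.choose (-frobeniusExponent p (m : ℤ_[p])) (k - i)) *
          padicLCoeffTame f m α (χ.ringHomComp (Rat.castHom ℚ_[p])) i := by
  classical
  set χp : DirichletCharacter ℚ_[p] m := χ.ringHomComp (Rat.castHom ℚ_[p]) with hχp_def
  have hα0 : α ≠ 0 := norm_ne_zero_iff.mp (by rw [hαu]; exact one_ne_zero)
  have hdist := sum_filter_weighted_msdMeasureTame_succ f hf (fun r ↦ ratCast_ratPlusSymbol_holds hf hQ r) hpN hmp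
    hap hα0 hα χp
  obtain ⟨C, hC⟩ := exists_norm_weighted_msdMeasureTame_le f
    (exists_nsmul_modularSymbol_mem_periodLattice_of_isNewform0 hf hQ) hαu χp
  obtain ⟨teich, hc⟩ := exists_teichmuller_frobeniusExponent p hmp
  have hRSdef : ∀ k n : ℕ, padicLRiemannSumTame f m α χp k n =
      ∑ᶠ zz : rootsOfUnity (torsionOrder p) ℤ_[p], ∑ s : ZMod (p ^ n),
        (fun (n : ℕ) (a : ZMod (p ^ n)) ↦ ∑ b : ZMod m, χp b * msdMeasureTame f m α n a b)
          (n + cyclotomicExponent p)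
          (PadicInt.toZModPow (n + cyclotomicExponent p) ((zz : ℤ_[p]ˣ) : ℤ_[p]) *
            (cyclotomicGenerator p : ZMod (p ^ (n + cyclotomicExponent p))) ^ s.val) *
          (s.val.choose k : ℚ_[p]) :=
    fun k n ↦ padicLRiemannSumTame_eq_sum_weighted f α χp k n
  set RSz : ℕ → ℕ → ℚ_[p] := fun k n ↦ ∑ᶠ zz : rootsOfUnity (torsionOrder p) ℤ_[p], ∑ s : ZMod (p ^ n),
        (fun (n : ℕ) (a : ZMod (p ^ n)) ↦ ∑ b : ZMod m, χp b * msdMeasureTame f m α n a b)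
          (n + cyclotomicExponent p)
          ((PadicInt.toZModPow (n + cyclotomicExponent p) ((teich : ℤ_[p]ˣ) : ℤ_[p]) *
              (cyclotomicGenerator p : ZMod (p ^ (n + cyclotomicExponent p))) ^
                (PadicInt.toZModPow n (frobeniusExponent p (m : ℤ_[p]))).val) *
            (PadicInt.toZModPow (n + cyclotomicExponent p) ((zz : ℤ_[p]ˣ) : ℤ_[p]) *
              (cyclotomicGenerator p : ZMod (p ^ (n + cyclotomicExponent p))) ^ s.val)) *
          ((s.val.choose k : ℕ) : ℚ_[p]) with hRSz_def
  have hRSz : ∀ k n : ℕ, RSz k n = ∑ᶠ zz : rootsOfUnity (torsionOrder p) ℤ_[p], ∑ s : ZMod (p ^ n),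
        (fun (n : ℕ) (a : ZMod (p ^ n)) ↦ ∑ b : ZMod m, χp b * msdMeasureTame f m α n a b)
          (n + cyclotomicExponent p)
          ((PadicInt.toZModPow (n + cyclotomicExponent p) ((teich : ℤ_[p]ˣ) : ℤ_[p]) *
              (cyclotomicGenerator p : ZMod (p ^ (n + cyclotomicExponent p))) ^
                (PadicInt.toZModPow n (frobeniusExponent p (m : ℤ_[p]))).val) *
            (PadicInt.toZModPow (n + cyclotomicExponent p) ((zz : ℤ_[p]ˣ) : ℤ_[p]) *
              (cyclotomicGenerator p : ZMod (p ^ (n + cyclotomicExponent p))) ^ s.val)) *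
          ((s.val.choose k : ℕ) : ℚ_[p]) := fun k n ↦ by rw [hRSz_def]
  have hlim := tendsto_riemannSum_translate hdist hC hRSdef hRSz k
  have hRS : ∀ n, padicLRiemannSum g (((χ (p : ZMod m) : ℚ) : ℚ_[p]) * α) k n = (c : ℚ_[p]) * RSz k n := fun n ↦ by
    rw [hRSz_def]
    exact padicLRiemannSum_twist_eq f g hmp χ hχp hB α hc k n
  have hT : Tendsto (padicLRiemannSum g (((χ (p : ZMod m) : ℚ) : ℚ_[p]) * α) k) atTop
      (𝓝 ((c : ℚ_[p]) * ∑ i ∈ Finset.range (k + 1),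
        algebraMap ℤ_[p] ℚ_[p] (Ring.choose (-frobeniusExponent p (m : ℤ_[p])) (k - i)) *
          limUnder atTop (fun n ↦ padicLRiemannSumTame f m α χp i n))) := by
    refine ((hlim.const_mul (c : ℚ_[p])).congr fun n ↦ ?_)
    exact (hRS n).symm
  rw [padicLCoeff, hT.limUnder_eq]
  rfl

omit [NeZero N'] in
/-- **Birch's lemma for the transforms.** Under the symbol-level twisting relation
`hB : ∀ x, [x]⁺_g = c · Σ_{b mod m} χ(b) [x + b/m]⁺_f` (`χ` a `ℚ`-valued character mod `m`, `(m,p) = 1`, `χ(p)² = 1`) and the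
standing hypotheses on `f` (rational normalised newform, `p ∤ N`, `α` the unit root):
`L_p(g, χ(p)α, T) = C(c) · (1+T)^{−f_m} · L_p(f, α, χ, T)` in `ℚ_p⟦T⟧`, `f_m = frobeniusExponent p m` (`γ_cyc^{f_m} = ⟨m⟩`),
`(1+T)^{−f_m} = binomialSeries ℚ_p (−f_m)`. [cite: MazurTateTeitelbaum1986Invent, §I.8–I.13 (pp. 10–19)] [cite: Matsuno2000, §2 (p. 84)] -/
theorem padicLFunction_twist_eq_of_birch (hf : IsNewform0 f) (hQ : coeffField f = ⊥) (hpN : ¬ p ∣ N) (hmp : m.Coprime p)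
    {ap : ℤ} (hap : cuspCoeff f p = ap) {α : ℚ_[p]} (hα : α ^ 2 - ap * α + p = 0) (hαu : ‖α‖ = 1)
    (χ : MulChar (ZMod m) ℚ) (hχp : χ (p : ZMod m) ^ 2 = 1) {c : ℚ}
    (hB : ∀ x : ℚ, ratPlusSymbol g x = c * ∑ b : ZMod m, χ b * ratPlusSymbol f (x + (b.val : ℚ) / m)) :
    padicLFunction g (((χ (p : ZMod m) : ℚ) : ℚ_[p]) * α) =
      C (c : ℚ_[p]) * PowerSeries.binomialSeries ℚ_[p] (-frobeniusExponent p (m : ℤ_[p])) *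
        padicLFunctionTame f m α (χ.ringHomComp (Rat.castHom ℚ_[p])) := by
  ext k
  rw [coeff_padicLFunction, padicLCoeff_twist_eq f g hf hQ hpN hmp hap hα hαu χ hχp hB k, coeff_C_mul_binomialSeries_mul]
  congr 1
  refine Finset.sum_congr rfl fun i _ ↦ ?_
  rw [coeff_padicLFunctionTame]

end BirchTransform

end Literature.NumberTheory.EllipticCurves

end
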